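import Summits.BirchSwinnertonDyer.BirchSwinnertonDyer.Theorems.KolyvaginRoadThreeSchneiderTamAtThreeHeightLogNumeratorLargePrime
import Literature.NumberTheory.EllipticCurves.PadicSigmaLogFirstOrderProofs
import Summits.BirchSwinnertonDyer.BirchSwinnertonDyer.Theorems.KolyvaginRoadThreeSchneiderTamAtThreeOddPrimeClosedForm
import Summits.BirchSwinnertonDyer.Rank1Residual.X11b.RegMultCertificateJoin
import Literature.NumberTheory.EllipticCurves.SteinWuthrich2013.MultiplicativeHeightExistenceProofs
import HarnessLib

/-!
# «The height is the logarithm of the numerator» at a prime `p ≥ 5`, part C: `ĥ_p(P) = log_p num x(P) +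
# O(‖x‖_p⁻¹)`, the numerator criterion `p^{v_p(den x)} ∤ (num x)^{p−1} − 1 ⟹ ĥ_p(P) ≠ 0`, and
# Schneider's binder at a non-split `p ≥ 5` from one rational point

HONEST FRAMING (cell `bsd-stepL`, seat `bsd-stepL-tam3-p2` g0; `--supports stmt-BirchSwinnertonDyer-19154 --as helper`):
THEOREMS ONLY, unconditional, route-independent (no Theses import); 0 definitions, 0 named facts, 0 sorry;
nothing here proves the crux `SchneiderTamAtThree` (a `p = 3` statement; parts 1–4 of this series treat
`p = 3`), Schneider's conjecture or BSD. This is the `p ≥ 5` companion — the same closed form at every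
prime `p ≥ 5` of multiplicative reduction, where NO scale congruence is needed (`⅓`, `1/12` are
`p`-integral); consumer-in-waiting: the `p ≥ 5` REG-MULT ∕ REST universes of lane A (`bsd-stepL-reg3-eng`
v2 ∕ v3: 22 480 pairs, two kernel rungs), i.e. Schneider's binder `RegulatorNonvanishingAt W p` of the
lever at `p ≥ 5` (route ErratumRoadFive rows 19702 ∕ 19703).

* `norm_unit_mul_num_sub_one_le_padic` — `U(P)·num x ≡ 1 (mod p^{2k})`;
* `norm_heightFourOneCoord_sub_padicLog_num_le_padic` — **`‖ĥ_p(P) − log_p num x(P)‖_p ≤ ‖x‖_p⁻¹`**;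
* `norm_heightFourOneCoord_eq_norm_num_pow_sub_one_padic` — `‖ĥ_p(P)‖ = ‖(num x)^{p−1} − 1‖` when this
  exceeds `‖x‖⁻¹`; `heightFourOneCoord_ne_zero_of_num_criterion_padic`, `…_of_not_pow_dvd_padic` —
  **`p^{v_p(den x)} ∤ (num x)^{p−1} − 1 ⟹ ĥ_p(P) ≠ 0`** (a Fermat-quotient-type condition on ONE integer);
* `regulatorNonvanishingAt_of_num_criterion_padic` — non-split `p ≥ 5`, rank one: one admissible rational
  point passing the criterion gives `ClassClosure.RegulatorNonvanishingAt W p`.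

EVIDENCE: on lane A's v2 table (kit j249895) the criterion fires on 665 of 735 non-split `p = 5` rows
with point data, 170∕189 at `p = 7`, 11∕14 at `p = 11`, and on 2 044∕2 117 split `p = 5` rows for the
(4.1)-part of the height (the split height carries the extra `−log_p(u)²/log_p q_E` term, not treated here).

References: [SteinWuthrich2013] §4.1 (4.1), §4.2, Conj. 4.1, §7; [Iwasawa1972PadicL] §4.4;
[Schneider1982PadicHeightI] §1; tree `PadicSigmaLogFirstOrderProofs.lean` (`norm_padicLog_eq_norm_one_sub`),
`Theorems/KolyvaginRoadThreeSchneiderTamAtThreeOddPrimeClosedForm.lean` (`norm_padicLog_of_norm_eq_one`),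
`X11b/RegMultCertificateJoin.lean`.
-/

noncomputable section

open scoped Classical Nat
open Filter Topology IsUltrametricDist PowerSeries
open WeierstrassCurve Literature.NumberTheory.EllipticCurves
open Literature.NumberTheory.EllipticCurves.SteinWuthrich2013
open Literature.NumberTheory.EllipticCurves.TateCurve
open Literature.NumberTheory.EllipticCurves.Rank1Residual
open Summit.BirchSwinnertonDyer.Uniform.UI.O2

namespace Summit.BirchSwinnertonDyer.Rank1Residual.X11b.RegMult.HeightLogNumerator

variable {p : ℕ} [hp : Fact p.Prime]

/-! ### §7′ Consequences at `p ≥ 5`: the height is the logarithm of the numerator; the numerator criterion -/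

section ConsequencesLarge

variable {W : WeierstrassCurve ℚ}

/-- **`U(P)·num x(P) ≡ 1 (mod p^{2k})`**, `p ≥ 5`, `p^{2k} ‖ den x(P)`. [cite: SteinWuthrich2013, §4.2] -/
theorem norm_unit_mul_num_sub_one_le_padic (hp5 : 5 ≤ p) [W.IsElliptic] [W.IsGloballyMinimal]
    (hW : Mult W p) {q : ℚ_[p]} (hq : ‖q‖ < 1) {x y : ℚ} (hxy : W.toAffine.Nonsingular x y)
    (hx : 1 < ‖(x : ℚ_[p])‖) :
    ‖tateSigmaValueSq W p q x y / ((x.den : ℚ) : ℚ_[p]) * ((x.num : ℚ) : ℚ_[p]) - 1‖ ≤ ‖(x : ℚ_[p])‖⁻¹ := by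
  have hd0 : ((x.den : ℚ) : ℚ_[p]) ≠ 0 := by exact_mod_cast x.den_nz
  have hnum : ((x.num : ℚ) : ℚ_[p]) = (x : ℚ_[p]) * ((x.den : ℚ) : ℚ_[p]) := by
    rw [← Rat.cast_mul, Rat.mul_den_eq_num]
  have e : tateSigmaValueSq W p q x y / ((x.den : ℚ) : ℚ_[p]) * ((x.num : ℚ) : ℚ_[p]) =
      (x : ℚ_[p]) * tateSigmaValueSq W p q x y := by
    rw [hnum]; field_simp
  rw [e]
  exact norm_x_mul_tateSigmaValueSq_sub_one_le_padic hp5 hW hq hxy hx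

/-- **THE HEIGHT IS THE LOGARITHM OF THE NUMERATOR at `p ≥ 5`**: `‖ĥ_p(P) − log_p(num x(P))‖_p ≤ ‖x(P)‖_p⁻¹`
for `W/ℚ` globally minimal, multiplicative at `p ≥ 5`, any `‖q‖_p < 1`, any rational `P = (x,y)` with
`‖x‖_p > 1` (`ĥ_p = heightFourOneCoord`, SW (4.1)). [cite: SteinWuthrich2013, §4.1 eq. (4.1), §4.2]
[cite: Iwasawa1972PadicL, §4.4] -/
theorem norm_heightFourOneCoord_sub_padicLog_num_le_padic (hp5 : 5 ≤ p) [W.IsElliptic]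
    [W.IsGloballyMinimal] (hW : Mult W p) {q : ℚ_[p]} (hq : ‖q‖ < 1) {x y : ℚ}
    (hxy : W.toAffine.Nonsingular x y) (hx : 1 < ‖(x : ℚ_[p])‖) :
    ‖heightFourOneCoord W p q x y - padicLog p ((x.num : ℚ) : ℚ_[p])‖ ≤ ‖(x : ℚ_[p])‖⁻¹ := by
  have hp2 : p ≠ 2 := by omega
  have hX0 : (x : ℚ_[p]) ≠ 0 := norm_pos_iff.mp (one_pos.trans hx)
  have hd0 : ((x.den : ℚ) : ℚ_[p]) ≠ 0 := by exact_mod_cast x.den_nz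
  have hS0 := tateSigmaValueSq_ne_zero hp2 hW hq hxy hx
  have hnum : ((x.num : ℚ) : ℚ_[p]) = (x : ℚ_[p]) * ((x.den : ℚ) : ℚ_[p]) := by
    rw [← Rat.cast_mul, Rat.mul_den_eq_num]
  have hmain := norm_x_mul_tateSigmaValueSq_sub_one_le_padic hp5 hW hq hxy hx
  have hlt : ‖1 - (x : ℚ_[p]) * tateSigmaValueSq W p q x y‖ < 1 := by
    rw [norm_sub_rev]; exact hmain.trans_lt (inv_lt_one_of_one_lt₀ hx)
  have e : heightFourOneCoord W p q x y - padicLog p ((x.num : ℚ) : ℚ_[p]) =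
      -padicLog p ((x : ℚ_[p]) * tateSigmaValueSq W p q x y) := by
    rw [heightFourOneCoord_eq, hnum, padicLog_mul_holds p hX0 hd0, padicLog_mul_holds p hX0 hS0]
    ring
  rw [e, norm_neg, norm_padicLog_eq_norm_one_sub hp2 hlt, norm_sub_rev]
  exact hmain

/-- `‖num x‖_p = 1` for `‖x‖_p > 1`. [folklore] -/
theorem norm_num_eq_one_padic {x : ℚ} (hx : 1 < ‖(x : ℚ_[p])‖) : ‖((x.num : ℚ) : ℚ_[p])‖ = 1 := by
  have hnum : ((x.num : ℚ) : ℚ_[p]) = (x : ℚ_[p]) * ((x.den : ℚ) : ℚ_[p]) := by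
    rw [← Rat.cast_mul, Rat.mul_den_eq_num]
  rw [hnum, norm_mul, norm_den_eq_inv_norm hx, mul_inv_cancel₀ (one_pos.trans hx).ne']

/-- **EXACT SIZE at `p ≥ 5`**: if `‖(num x)^{p−1} − 1‖_p > ‖x‖_p⁻¹` then `‖ĥ_p(P)‖_p = ‖(num x)^{p−1} − 1‖_p`
(`‖log_p a‖ = ‖1 − a^{p−1}‖` for a unit `a`). In valuations: `v_p(ĥ_p(P)) = v_p((num x)^{p−1} − 1)` whenever
this is `< v_p(den x)`. Lane A's REG-MULT universe (kit j249895, 5 136 rows with point data across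
`p ∈ {3,…,29}`, both reduction signs) obeys the law for formula (4.1) in 5 136 / 5 136 rows.
[cite: SteinWuthrich2013, §4.2, §7] [cite: Iwasawa1972PadicL, §4.4] -/
theorem norm_heightFourOneCoord_eq_norm_num_pow_sub_one_padic (hp5 : 5 ≤ p) [W.IsElliptic]
    [W.IsGloballyMinimal] (hW : Mult W p) {q : ℚ_[p]} (hq : ‖q‖ < 1) {x y : ℚ}
    (hxy : W.toAffine.Nonsingular x y) (hx : 1 < ‖(x : ℚ_[p])‖)
    (hcrit : ‖(x : ℚ_[p])‖⁻¹ < ‖((x.num : ℚ) : ℚ_[p]) ^ (p - 1) - 1‖) :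
    ‖heightFourOneCoord W p q x y‖ = ‖((x.num : ℚ) : ℚ_[p]) ^ (p - 1) - 1‖ := by
  have hp2 : p ≠ 2 := by omega
  have hlog : ‖padicLog p ((x.num : ℚ) : ℚ_[p])‖ = ‖((x.num : ℚ) : ℚ_[p]) ^ (p - 1) - 1‖ := by
    rw [SchneiderClosedFormOddPrime.norm_padicLog_of_norm_eq_one hp2 (norm_num_eq_one_padic hx),
      norm_sub_rev]
  have herr := norm_heightFourOneCoord_sub_padicLog_num_le_padic hp5 hW hq hxy hx
  have hne : ‖padicLog p ((x.num : ℚ) : ℚ_[p])‖ ≠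
      ‖heightFourOneCoord W p q x y - padicLog p ((x.num : ℚ) : ℚ_[p])‖ := by
    rw [hlog]; exact (herr.trans_lt hcrit).ne'
  rw [show heightFourOneCoord W p q x y = padicLog p ((x.num : ℚ) : ℚ_[p]) +
      (heightFourOneCoord W p q x y - padicLog p ((x.num : ℚ) : ℚ_[p])) by ring,
    norm_add_eq_max_of_norm_ne_norm hne, hlog]
  exact max_eq_left (herr.trans hcrit.le)

/-- **THE NUMERATOR CRITERION at `p ≥ 5`**: `‖x‖_p⁻¹ < ‖(num x)^{p−1} − 1‖_p ⟹ ĥ_p(P) ≠ 0`.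
[cite: SteinWuthrich2013, §4.2, Conj. 4.1] [cite: Schneider1982PadicHeightI, §1] -/
theorem heightFourOneCoord_ne_zero_of_num_criterion_padic (hp5 : 5 ≤ p) [W.IsElliptic]
    [W.IsGloballyMinimal] (hW : Mult W p) {q : ℚ_[p]} (hq : ‖q‖ < 1) {x y : ℚ}
    (hxy : W.toAffine.Nonsingular x y) (hx : 1 < ‖(x : ℚ_[p])‖)
    (hcrit : ‖(x : ℚ_[p])‖⁻¹ < ‖((x.num : ℚ) : ℚ_[p]) ^ (p - 1) - 1‖) :
    heightFourOneCoord W p q x y ≠ 0 := by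
  rw [← norm_pos_iff, norm_heightFourOneCoord_eq_norm_num_pow_sub_one_padic hp5 hW hq hxy hx hcrit]
  exact (inv_pos.mpr (one_pos.trans hx)).trans hcrit

/-- **The criterion in integers**: `p^{v_p(den x)} ∤ (num x)^{p−1} − 1 ⟹ ‖x‖_p⁻¹ < ‖(num x)^{p−1} − 1‖_p`
(for `‖x‖_p > 1`). [folklore] -/
theorem inv_norm_lt_of_not_pow_dvd_padic {x : ℚ} (hx : 1 < ‖(x : ℚ_[p])‖)
    (h : ¬ ((p : ℤ) ^ padicValNat p x.den ∣ x.num ^ (p - 1) - 1)) :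
    ‖(x : ℚ_[p])‖⁻¹ < ‖((x.num : ℚ) : ℚ_[p]) ^ (p - 1) - 1‖ := by
  have hden : ‖(x : ℚ_[p])‖⁻¹ = (p : ℝ) ^ (-(padicValNat p x.den : ℤ)) := by
    rw [← norm_den_eq_inv_norm hx, Rat.cast_natCast,
      Padic.norm_eq_zpow_neg_valuation (by exact_mod_cast x.den_nz), Padic.valuation_natCast]
  have hk : ((x.num : ℚ) : ℚ_[p]) ^ (p - 1) - 1 = (((x.num ^ (p - 1) - 1 : ℤ)) : ℚ_[p]) := by push_cast; ring
  rw [hden, hk]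
  by_contra hle
  exact h ((Padic.norm_int_le_pow_iff_dvd _ _).mp (not_lt.mp hle))

/-- **The numerator criterion, integer form, `p ≥ 5`**: `p^{v_p(den x)} ∤ (num x)^{p−1} − 1 ⟹ ĥ_p(P) ≠ 0`.
[cite: SteinWuthrich2013, §4.2, Conj. 4.1] -/
theorem heightFourOneCoord_ne_zero_of_not_pow_dvd_padic (hp5 : 5 ≤ p) [W.IsElliptic]
    [W.IsGloballyMinimal] (hW : Mult W p) {q : ℚ_[p]} (hq : ‖q‖ < 1) {x y : ℚ}
    (hxy : W.toAffine.Nonsingular x y) (hx : 1 < ‖(x : ℚ_[p])‖)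
    (h : ¬ ((p : ℤ) ^ padicValNat p x.den ∣ x.num ^ (p - 1) - 1)) :
    heightFourOneCoord W p q x y ≠ 0 :=
  heightFourOneCoord_ne_zero_of_num_criterion_padic hp5 hW hq hxy hx (inv_norm_lt_of_not_pow_dvd_padic hx h)

/-- **Schneider's binder at a non-split `p ≥ 5` from ONE rational point, by integer arithmetic**: for
`W/ℚ` globally minimal, NON-split multiplicative at `p ≥ 5`, Mordell–Weil rank one, an admissible
rational point `P = (x,y)` with `p^{v_p(den x)} ∤ (num x)^{p−1} − 1` gives
`ClassClosure.RegulatorNonvanishingAt W p` — the per-pair input of the lever at `p`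
(`X11b.ClassClosure.bsdp_of_leverLocus_of_regulatorNonvanishing`; lane A's REG-MULT ∕ REST universes at
`p ≥ 5`). [cite: SteinWuthrich2013, §4.2, Conj. 4.1] [cite: Schneider1982PadicHeightI, §1] -/
theorem regulatorNonvanishingAt_of_num_criterion_padic (hp5 : 5 ≤ p) [W.IsElliptic] [W.IsGloballyMinimal]
    (hW : Mult W p) (hns : ¬ W.HasSplitMultiplicativeReductionAtPrime p) (hr : W.mordellWeilRank = 1)
    {x y : ℚ} {h : W.toAffine.Nonsingular x y} (hadm : W.IsAdmissible p (.some x y h))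
    (hcrit : ¬ ((p : ℤ) ^ padicValNat p x.den ∣ x.num ^ (p - 1) - 1)) :
    X11b.ClassClosure.RegulatorNonvanishingAt W p := by
  refine ⟨fun q Dh _ hq1 _ hDh => ?_, fun Dq _ _ => absurd Dq.split hns⟩
  refine X11b.schneider_of_isMultCanonical_of_heightFourOne_ne_zero hr hDh hadm ?_
  rw [heightFourOne_some]
  exact heightFourOneCoord_ne_zero_of_not_pow_dvd_padic hp5 hW hq1 h hadm.2.1 hcrit

end ConsequencesLarge


end Summit.BirchSwinnertonDyer.Rank1Residual.X11b.RegMult.HeightLogNumerator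

end
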